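import Mathlib.RingTheory.Ideal.Height
import Mathlib.RingTheory.Ideal.KrullsHeightTheorem
import Mathlib.RingTheory.Ideal.MinimalPrime.Localization
import Mathlib.RingTheory.Spectrum.Prime.RingHom
import Mathlib.Order.KrullDimension
import HarnessLib

/-!
# Special branches are oversized (crux `EquisingularLift`, honest variant EL♮ = `EquisingularLiftNat`,
# stmt-ResolutionOfSingularities-20038; idea card 8 `expected-dimension-lifts`, step (b))

[OURS · L W4.5 (b)] Helper for the round-4 idea card 8 `expected-dimension-lifts` of `res-L1-w45b-idea-2`
(`Cruxes/EquisingularLift/Ideas/`, Sketch `HOME/L/res-L1-w45b-idea-2/Sketch-L1-idea-2.lean` v5, decl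
`OversizedSpecialBranch`). NOT a statement of the manuscript under review (Hironaka 2017); nothing here is
attributed to its author. Pure commutative algebra.

**Statement (verbatim the Sketch's `OversizedSpecialBranch`).** `S` Noetherian, `ϖ` a non-zero-divisor of
`S`, `I = (f₁, …, f_o)`. A minimal prime `𝔓` of `I` containing `ϖ` — a branch of `Spec S/I` lying entirely
inside the special fibre `ϖ = 0` — has image of height `≤ o − 1` in `S/(ϖ)`:
`height (𝔓 · S/(ϖ)) + 1 ≤ o`.

**Proof.** Krull's height theorem gives `height 𝔓 ≤ o`. A chain of primes of `S/(ϖ)` below `𝔓̄` is a chain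
of primes of `S` containing `ϖ` below `𝔓`; its bottom member contains the non-zero-divisor `ϖ`, so it is not
a minimal prime of `S` (`Ideal.disjoint_nonZeroDivisors_of_mem_minimalPrimes`) and the chain extends by one:
`height 𝔓̄ + 1 ≤ height 𝔓`.
-/

set_option linter.dupNamespace false

noncomputable section

namespace Summit.ResolutionOfSingularities.ResolutionOfSingularities.Theorems.EquisingularLift.SpecialBranch

open scoped nonZeroDivisors

/-- Krull's height theorem for a family indexed by `Fin n`: a minimal prime of the ideal spanned by
`n` elements of a Noetherian ring has height at most `n`. OURS (Mathlib
`Ideal.height_le_card_of_mem_minimalPrimes_span_finset`, re-indexed). -/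
theorem height_le_of_mem_minimalPrimes_span_range {S : Type*} [CommRing S] [IsNoetherianRing S]
    {n : ℕ} (f : Fin n → S) {𝔓 : Ideal S} (h𝔓 : 𝔓 ∈ (Ideal.span (Set.range f)).minimalPrimes) :
    𝔓.height ≤ n := by
  classical
  have hset : ((Finset.univ.image f : Finset S) : Set S) = Set.range f := by
    rw [Finset.coe_image, Finset.coe_univ, Set.image_univ]
  rw [← hset] at h𝔓
  refine (Ideal.height_le_card_of_mem_minimalPrimes_span_finset h𝔓).trans ?_
  exact_mod_cast Finset.card_image_le.trans (by rw [Finset.card_univ, Fintype.card_fin])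

/-- **Chains through a non-zero-divisor extend by one.** If `ϖ` is a non-zero-divisor of `S` and `𝔓` a
prime containing `ϖ`, then `height (𝔓 · S/(ϖ)) + 1 ≤ height 𝔓`: a chain of primes of `S/(ϖ)` ending at
the image of `𝔓` pulls back to a chain of primes of `S` containing `ϖ` ending at `𝔓`, whose bottom member
is not a minimal prime of `S` (minimal primes consist of zero-divisors), so a minimal prime of `S` can be
prepended. No Noetherian hypothesis. OURS. -/
theorem height_map_quotient_add_one_le {S : Type*} [CommRing S] {ϖ : S} (hϖ : ϖ ∈ S⁰)
    (𝔓 : Ideal S) [𝔓.IsPrime] (hϖ𝔓 : ϖ ∈ 𝔓) :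
    (𝔓.map (Ideal.Quotient.mk (Ideal.span {ϖ}))).height + 1 ≤ 𝔓.height := by
  set I : Ideal S := Ideal.span {ϖ} with hI
  have hI𝔓 : I ≤ 𝔓 := (Ideal.span_singleton_le_iff_mem _).mpr hϖ𝔓
  haveI h𝔓' : (𝔓.map (Ideal.Quotient.mk I)).IsPrime := Ideal.isPrime_map_quotientMk_of_isPrime hI𝔓
  let P' : PrimeSpectrum (S ⧸ I) := ⟨𝔓.map (Ideal.Quotient.mk I), h𝔓'⟩
  let P : PrimeSpectrum S := ⟨𝔓, ‹_›⟩
  have hsm : StrictMono (PrimeSpectrum.comap (Ideal.Quotient.mk I)) :=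
    RingHom.strictMono_comap_of_surjective Ideal.Quotient.mk_surjective
  have hcomap : PrimeSpectrum.comap (Ideal.Quotient.mk I) P' = P := by
    ext1
    change Ideal.comap (Ideal.Quotient.mk I) (𝔓.map (Ideal.Quotient.mk I)) = 𝔓
    rw [Ideal.comap_map_of_surjective _ Ideal.Quotient.mk_surjective, sup_eq_left]
    exact le_trans (le_of_eq Ideal.mk_ker) hI𝔓
  change P'.asIdeal.height + 1 ≤ P.asIdeal.height
  rw [PrimeSpectrum.height_eq_orderHeight, PrimeSpectrum.height_eq_orderHeight]
  have hne : Nonempty {q : LTSeries (PrimeSpectrum (S ⧸ I)) // q.last = P'} :=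
    ⟨⟨RelSeries.singleton _ P', rfl⟩⟩
  rw [Order.height_eq_iSup_last_eq P', iSup_subtype', ENat.iSup_add, iSup_le_iff]
  rintro ⟨q, hq⟩
  let q' : LTSeries (PrimeSpectrum S) := q.map (PrimeSpectrum.comap (Ideal.Quotient.mk I)) hsm
  have hq'last : q'.last = P := by
    rw [LTSeries.last_map, hq, hcomap]
  have hq'head : ϖ ∈ q'.head.asIdeal := by
    rw [LTSeries.head_map]
    change ϖ ∈ Ideal.comap (Ideal.Quotient.mk I) q.head.asIdeal
    rw [Ideal.mem_comap, Ideal.Quotient.eq_zero_iff_mem.mpr (Ideal.mem_span_singleton_self ϖ)]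
    exact zero_mem _
  obtain ⟨p, hp, hp'⟩ := Ideal.exists_minimalPrimes_le (J := q'.head.asIdeal) (I := ⊥) bot_le
  let p₀ : PrimeSpectrum S := ⟨p, hp.1.1⟩
  have hlt : p₀ < q'.head := lt_of_le_of_ne hp' fun h => Set.disjoint_iff.mp
    (Ideal.disjoint_nonZeroDivisors_of_mem_minimalPrimes hp)
    ⟨show ϖ ∈ p by simpa [← h] using hq'head, hϖ⟩
  have hlen := Order.length_le_height_last (p := q'.cons p₀ hlt)
  rw [RelSeries.last_cons, hq'last, RelSeries.cons_length] at hlen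
  have hql : q'.length = q.length := rfl
  rw [hql] at hlen
  exact_mod_cast hlen

/-- **Card 8, step (b): special branches are oversized** (verbatim the Sketch's `OversizedSpecialBranch`).
`S` Noetherian, `ϖ` a non-zero-divisor of `S` (read `p` in `W⟦t₁…t_h⟧`), `I = (f₁,…,f_o)`. A minimal prime
`𝔓` of `I` containing `ϖ` — a branch of `Spec S/I` lying entirely inside the special fibre — has image of
height `≤ o − 1` in `S/(ϖ)`: inside the special fibre the branch has codimension at most `o − 1`, one LESS
than expected. [Krull's height theorem `height 𝔓 ≤ o` and `height_map_quotient_add_one_le`.] OURS; idea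
card 8 `expected-dimension-lifts` of res-L1-w45b-idea-2 (L W4.5 (b), EL♮ stmt-ResolutionOfSingularities-20038);
not a statement of the manuscript under review. -/
theorem OversizedSpecialBranch :
  ∀ (S : Type) [CommRing S] [IsNoetherianRing S] (ϖ : S), ϖ ∈ nonZeroDivisors S → ∀ (o : ℕ) (f : Fin o → S)
    (𝔓 : Ideal S), 𝔓 ∈ (Ideal.span (Set.range f)).minimalPrimes → ϖ ∈ 𝔓 →
    (𝔓.map (Ideal.Quotient.mk (Ideal.span {ϖ}))).height + 1 ≤ (o : ℕ∞) := by
  intro S _ _ ϖ hϖ o f 𝔓 h𝔓 hϖ𝔓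
  haveI : 𝔓.IsPrime := h𝔓.1.1
  exact (height_map_quotient_add_one_le hϖ 𝔓 hϖ𝔓).trans (height_le_of_mem_minimalPrimes_span_range f h𝔓)

end Summit.ResolutionOfSingularities.ResolutionOfSingularities.Theorems.EquisingularLift.SpecialBranch

end
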